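import Summits.Ventures.PercRepro.C025ProfileOneCircuitA
import Summits.Ventures.PercRepro.C025ProfileCascadeArith

/-!
# THE ROW `(q, q+1)` ON THE ONE-SHORT-CIRCUIT CLASS 𝒞(q) — part B: (Cap) AND THEOREM 𝒞(q) (night-3 g14)
`proofs/NIGHT3-G14-SIZE.md` §5c; part A = `C025ProfileOneCircuitA` (structure, (Dem)). (Cap) for the two shapes of a rank-`(q+1)` set:
`|S| = q + 1`, `K ⊄ S` (`cap_shape1`: the loaders are `S ∖ {c}`, the load is `(q+1) z_F`, `z_J + q g_J` or `2 g_I + (q−1) s_I` by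
`|S ∩ K|`) and `|S| = q + 2`, `K ⊆ S` (`cap_shape2`: `q − 1` loaders `S ∖ {c}` containing `K` paying `1`, at most `3(q−1)` loaders
`S ∖ {k, c}` paying `s_Q`). `profileIneq_oneCircuit_of_weights`: the row and its Hall form for ANY weights with the cascade
(Dem)/(Cap) arithmetic; **THEOREM 𝒞(q)** `profileIneq_oneCircuit` / `profileIneq_oneCircuit'` / `hallIneq_oneCircuit`: for every
`q ≥ 2` and every finite matroid with a 3-circuit `K` such that every set of `≤ q + 2` points not containing `K` is independent, the
row `(q, q+1)` of C-032 and its Hall form (C-033) hold — the cascade weights of `C025ProfileCascadeArith` when `|E| − q − 1 ≥ q`, the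
zero certificate otherwise. This class contains g13's `M_q` (+ generic points) at EVERY size, in particular `n = 2q + 2` where the simple
rule of ThinRow A–E fails for every `q ≥ 6`: the first row theorem of the Π lane below the simple rule's boundary.
-/
open scoped Matroid
namespace PercRepro
open Set Finset ThmH Staged
namespace OneCircuit
variable {α : Type} [DecidableEq α] {M : Matroid α} [M.Finite]

/-- The `(q+1)`-subsets of a set are the sets `S ∖ {c}`, `c ∈ S`, when `|S| = q + 2` (as an inclusion into the image). -/
theorem powersetCard_pred_subset_image {S : Finset α} {k : ℕ} (hSc : S.card = k + 1) :
    Finset.powersetCard k S ⊆ S.image (fun c => S.erase c) := by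
  intro B hB
  rw [Finset.mem_powersetCard] at hB
  obtain ⟨hBS, hBc⟩ := hB
  have hcard : (S \ B).card = 1 := by rw [Finset.card_sdiff_of_subset hBS]; omega
  obtain ⟨c, hc⟩ := Finset.card_eq_one.mp hcard
  have hcS : c ∈ S := (Finset.mem_sdiff.mp (hc ▸ Finset.mem_singleton_self c)).1
  rw [Finset.mem_image]
  refine ⟨c, hcS, ?_⟩
  apply Finset.eq_of_subset_of_card_le
  · intro x hx
    rw [Finset.mem_erase] at hx
    by_contra hxB
    have : x ∈ S \ B := Finset.mem_sdiff.mpr ⟨hx.2, hxB⟩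
    rw [hc, Finset.mem_singleton] at this
    exact hx.1 this
  · rw [Finset.card_erase_of_mem hcS]; omega

/-- **(Cap), shape 1** (`|S| = q + 1`, `K ⊄ S`): the loaders are the sets `S ∖ {c}`, `c ∈ S`; the load is `(q+1) z_F`,
`z_J + q g_J` or `2 g_I + (q−1) s_I` according to `|S ∩ K| = 0, 1, 2`. -/
theorem cap_shape1 {q : ℕ} {K : Finset α} (hK3 : K.card = 3) (hKrk : rkN M K = 2)
    (hclass : ∀ X ⊆ gr M, X.card ≤ q + 2 → ¬ K ⊆ X → rkN M X = X.card)
    (w : Finset α → Finset α → ℚ) (hw_nonneg : ∀ B S, 0 ≤ w B S) (sI gI gJ zJ zF : ℚ)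
    (hw_2I : ∀ B S : Finset α, B.card = q → (B ∩ K).card = 2 → S.card = q + 1 → w B S = sI)
    (hw_GI : ∀ B S : Finset α, B.card = q → (B ∩ K).card = 1 → S.card = q + 1 → (S ∩ K).card = 2 → w B S = gI)
    (hw_GJ : ∀ B S : Finset α, B.card = q → (B ∩ K).card = 1 → S.card = q + 1 → (S ∩ K).card = 1 → w B S = gJ)
    (hw_ZJ : ∀ B S : Finset α, B.card = q → (B ∩ K).card = 0 → S.card = q + 1 → (S ∩ K).card = 1 → w B S = zJ)
    (hw_ZF : ∀ B S : Finset α, B.card = q → (B ∩ K).card = 0 → S.card = q + 1 → (S ∩ K).card = 0 → w B S = zF)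
    (hcapF : ((q : ℚ) + 1) * zF ≤ q + 1) (hcapJ : zJ + (q : ℚ) * gJ ≤ q + 1)
    (hcapI : 2 * gI + ((q : ℚ) - 1) * sI ≤ q + 1) (hq : 1 ≤ q)
    {S : Finset α} (hSc : S.card = q + 1) (hKS : ¬ K ⊆ S) :
    ∑ B ∈ (Profile.Rq M q).filter (fun B => B ⊆ S), w B S ≤ (q : ℚ) + 1 := by
  have hsub : (Profile.Rq M q).filter (fun B => B ⊆ S) ⊆ S.image (fun c => S.erase c) := by
    intro B hB
    rw [Finset.mem_filter, Profile.mem_Rq] at hB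
    obtain ⟨⟨hBg, hBr⟩, hBS⟩ := hB
    have hBq : rkN M B = q := rkN_eq_iff.mpr hBr
    rcases rank_q_cases hK3 hKrk hclass hBg hBq with ⟨hBc, -⟩ | ⟨-, hKB⟩
    · exact powersetCard_pred_subset_image hSc (Finset.mem_powersetCard.mpr ⟨hBS, hBc⟩)
    · exact absurd (hKB.trans hBS) hKS
  have hsum : ∑ B ∈ (Profile.Rq M q).filter (fun B => B ⊆ S), w B S ≤ ∑ c ∈ S, w (S.erase c) S := by
    calc ∑ B ∈ (Profile.Rq M q).filter (fun B => B ⊆ S), w B S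
        ≤ ∑ B ∈ S.image (fun c => S.erase c), w B S :=
          Finset.sum_le_sum_of_subset_of_nonneg hsub (fun B _ _ => hw_nonneg B S)
      _ = ∑ c ∈ S, w (S.erase c) S := Finset.sum_image (Finset.erase_injOn S)
  have hm : (S ∩ K).card ≤ 3 := (Finset.card_le_card Finset.inter_subset_right).trans hK3.le
  have hm3 : (S ∩ K).card ≠ 3 := fun h => hKS ((subset_iff_card_inter_eq hK3).mpr h)
  have hce : ∀ c ∈ S, (S.erase c).card = q := fun c hc => by rw [Finset.card_erase_of_mem hc, hSc]; omega
  have hSK : (S \ K).card + (S ∩ K).card = S.card := Finset.card_sdiff_add_card_inter S K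
  rcases (by omega : (S ∩ K).card = 0 ∨ (S ∩ K).card = 1 ∨ (S ∩ K).card = 2) with h0 | h1 | h2
  · -- free
    have heval : ∀ c ∈ S, w (S.erase c) S = zF := by
      intro c hc
      have hi := card_erase_inter S K hc
      have hcK : c ∉ K := by
        intro hcK
        have : c ∈ S ∩ K := Finset.mem_inter.mpr ⟨hc, hcK⟩
        rw [Finset.card_eq_zero] at h0
        rw [h0] at this
        exact Finset.notMem_empty _ this
      rw [if_neg hcK, h0] at hi
      exact hw_ZF _ _ (hce c hc) hi hSc h0
    rw [Finset.sum_congr rfl heval, Finset.sum_const, nsmul_eq_mul, hSc] at hsum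
    push_cast at hsum
    linarith
  · -- J
    have heval : ∀ c ∈ S, w (S.erase c) S = if c ∈ K then zJ else gJ := by
      intro c hc
      have hi := card_erase_inter S K hc
      split_ifs with hcK
      · rw [if_pos hcK, h1] at hi; exact hw_ZJ _ _ (hce c hc) hi hSc h1
      · rw [if_neg hcK, h1] at hi; exact hw_GJ _ _ (hce c hc) hi hSc h1
    rw [Finset.sum_congr rfl heval, sum_ite_mem_eq, h1] at hsum
    have hq' : (S \ K).card = q := by omega
    rw [hq'] at hsum
    push_cast at hsum
    linarith
  · -- I
    have heval : ∀ c ∈ S, w (S.erase c) S = if c ∈ K then gI else sI := by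
      intro c hc
      have hi := card_erase_inter S K hc
      split_ifs with hcK
      · rw [if_pos hcK, h2] at hi; exact hw_GI _ _ (hce c hc) hi hSc h2
      · rw [if_neg hcK, h2] at hi; exact hw_2I _ _ (hce c hc) hi hSc
    rw [Finset.sum_congr rfl heval, sum_ite_mem_eq, h2] at hsum
    have hq' : (S \ K).card = q - 1 := by omega
    rw [hq', Nat.cast_sub hq] at hsum
    push_cast at hsum
    linarith

/-- **(Cap), shape 2** (`|S| = q + 2`, `K ⊆ S`): the loaders are the `(q+1)`-sets `S ∖ {c}` containing `K` (`c ∉ K`, paying `1`) and the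
`q`-sets `S ∖ {k, c}` with two points of `K` (paying `s_Q`); the load is at most `(q−1) + 3(q−1) s_Q`. -/
theorem cap_shape2 {q : ℕ} {K : Finset α} (hK3 : K.card = 3) (hKrk : rkN M K = 2)
    (hclass : ∀ X ⊆ gr M, X.card ≤ q + 2 → ¬ K ⊆ X → rkN M X = X.card)
    (w : Finset α → Finset α → ℚ) (hw_nonneg : ∀ B S, 0 ≤ w B S) (sQ : ℚ)
    (hw_a : ∀ B S : Finset α, B.card = q + 1 → (B ∩ K).card = 3 → S.card = q + 2 → w B S = 1)
    (hw_a0 : ∀ B S : Finset α, B.card = q + 1 → (B ∩ K).card ≠ 3 → w B S = 0)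
    (hw_2Q : ∀ B S : Finset α, B.card = q → (B ∩ K).card = 2 → S.card = q + 2 → (S ∩ K).card = 3 → w B S = sQ)
    (hw_q0 : ∀ B S : Finset α, B.card = q → S.card = q + 2 → (B ∩ K).card ≠ 2 → w B S = 0)
    (hsQ : 0 ≤ sQ) (hcapQ : ((q : ℚ) - 1) + 3 * ((q : ℚ) - 1) * sQ ≤ q + 1) (hq : 1 ≤ q)
    {S : Finset α} (hSc : S.card = q + 2) (hKS : K ⊆ S) :
    ∑ B ∈ (Profile.Rq M q).filter (fun B => B ⊆ S), w B S ≤ (q : ℚ) + 1 := by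
  have hSK : (S ∩ K).card = 3 := (subset_iff_card_inter_eq hK3).mp hKS
  have hSdK : (S \ K).card = q - 1 := by rw [Finset.card_sdiff_of_subset hKS, hSc, hK3]; omega
  have hsub : (Profile.Rq M q).filter (fun B => B ⊆ S) ⊆
      Finset.powersetCard (q + 1) S ∪ Finset.powersetCard q S := by
    intro B hB
    rw [Finset.mem_filter, Profile.mem_Rq] at hB
    obtain ⟨⟨hBg, hBr⟩, hBS⟩ := hB
    have hBq : rkN M B = q := rkN_eq_iff.mpr hBr
    rw [Finset.mem_union, Finset.mem_powersetCard, Finset.mem_powersetCard]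
    rcases rank_q_cases hK3 hKrk hclass hBg hBq with ⟨hBc, -⟩ | ⟨hBc, -⟩
    · right; exact ⟨hBS, hBc⟩
    · left; exact ⟨hBS, hBc⟩
  have hdisj : Disjoint (Finset.powersetCard (q + 1) S) (Finset.powersetCard q S) := by
    rw [Finset.disjoint_left]
    intro B h1 h2
    rw [Finset.mem_powersetCard] at h1 h2
    omega
  have hle : ∑ B ∈ (Profile.Rq M q).filter (fun B => B ⊆ S), w B S ≤
      ∑ B ∈ Finset.powersetCard (q + 1) S ∪ Finset.powersetCard q S, w B S :=
    Finset.sum_le_sum_of_subset_of_nonneg hsub (fun B _ _ => hw_nonneg B S)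
  rw [Finset.sum_union hdisj] at hle
  -- the `(q+1)`-subsets: load `q − 1`
  have hP1 : ∑ B ∈ Finset.powersetCard (q + 1) S, w B S ≤ (q : ℚ) - 1 := by
    calc ∑ B ∈ Finset.powersetCard (q + 1) S, w B S
        ≤ ∑ B ∈ S.image (fun c => S.erase c), w B S :=
          Finset.sum_le_sum_of_subset_of_nonneg (powersetCard_pred_subset_image hSc) (fun B _ _ => hw_nonneg B S)
      _ = ∑ c ∈ S, w (S.erase c) S := Finset.sum_image (Finset.erase_injOn S)
      _ = ∑ c ∈ S, (if c ∈ K then (0 : ℚ) else 1) := by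
          apply Finset.sum_congr rfl
          intro c hc
          have hi := card_erase_inter S K hc
          have hcc : (S.erase c).card = q + 1 := by rw [Finset.card_erase_of_mem hc, hSc]; omega
          split_ifs with hcK
          · rw [if_pos hcK, hSK] at hi; exact hw_a0 _ _ hcc (by omega)
          · rw [if_neg hcK, hSK] at hi; exact hw_a _ _ hcc hi hSc
      _ = ((S ∩ K).card : ℚ) * 0 + ((S \ K).card : ℚ) * 1 := sum_ite_mem_eq S K 0 1
      _ = (q : ℚ) - 1 := by rw [hSK, hSdK, Nat.cast_sub hq]; push_cast; ring
  -- the `q`-subsets: load `≤ 3 (q − 1) s_Q`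
  have hP0 : ∑ B ∈ Finset.powersetCard q S, w B S ≤ 3 * ((q : ℚ) - 1) * sQ := by
    have heval : ∀ B ∈ Finset.powersetCard q S, w B S = if (B ∩ K).card = 2 then sQ else 0 := by
      intro B hB
      rw [Finset.mem_powersetCard] at hB
      split_ifs with h2
      · exact hw_2Q B S hB.2 h2 hSc hSK
      · exact hw_q0 B S hB.2 hSc h2
    rw [Finset.sum_congr rfl heval, Finset.sum_ite, Finset.sum_const_zero, add_zero, Finset.sum_const, nsmul_eq_mul]
    have hcount : ((Finset.powersetCard q S).filter (fun B => (B ∩ K).card = 2)).card ≤ 3 * (q - 1) := by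
      have himg : (Finset.powersetCard q S).filter (fun B => (B ∩ K).card = 2) ⊆
          (K ×ˢ (S \ K)).image (fun p => (S.erase p.1).erase p.2) := by
        intro B hB
        rw [Finset.mem_filter, Finset.mem_powersetCard] at hB
        obtain ⟨⟨hBS, hBc⟩, hB2⟩ := hB
        have hKB : (K \ B).card = 1 := by have := card_sdiff_add_card_inter' K B; omega
        obtain ⟨k, hk⟩ := Finset.card_eq_one.mp hKB
        have hkK : k ∈ K := (Finset.mem_sdiff.mp (hk ▸ Finset.mem_singleton_self k)).1
        have hkB : k ∉ B := (Finset.mem_sdiff.mp (hk ▸ Finset.mem_singleton_self k)).2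
        have hSB : (S \ B).card = 2 := by rw [Finset.card_sdiff_of_subset hBS]; omega
        have hSBK : ((S \ B) ∩ K).card = 1 := by
          have heq : (S \ B) ∩ K = K \ B := by
            ext x
            simp only [Finset.mem_inter, Finset.mem_sdiff]
            constructor
            · rintro ⟨⟨_, hxB⟩, hxK⟩; exact ⟨hxK, hxB⟩
            · rintro ⟨hxK, hxB⟩; exact ⟨⟨hKS hxK, hxB⟩, hxK⟩
          rw [heq, hKB]
        have hSBK' : ((S \ B) \ K).card = 1 := by have := Finset.card_sdiff_add_card_inter (S \ B) K; omega
        obtain ⟨c, hc⟩ := Finset.card_eq_one.mp hSBK'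
        have hcmem : c ∈ (S \ B) \ K := hc ▸ Finset.mem_singleton_self c
        have hcS : c ∈ S := (Finset.mem_sdiff.mp (Finset.mem_sdiff.mp hcmem).1).1
        have hcB : c ∉ B := (Finset.mem_sdiff.mp (Finset.mem_sdiff.mp hcmem).1).2
        have hcK : c ∉ K := (Finset.mem_sdiff.mp hcmem).2
        have hkc : k ≠ c := fun h => hcK (h ▸ hkK)
        have hpair : S \ B = {k, c} := by
          symm
          apply Finset.eq_of_subset_of_card_le
          · intro x hx
            rw [Finset.mem_insert, Finset.mem_singleton] at hx
            rcases hx with rfl | rfl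
            · exact Finset.mem_sdiff.mpr ⟨hKS hkK, hkB⟩
            · exact Finset.mem_sdiff.mpr ⟨hcS, hcB⟩
          · rw [Finset.card_pair hkc]; omega
        rw [Finset.mem_image]
        refine ⟨(k, c), Finset.mem_product.mpr ⟨hkK, Finset.mem_sdiff.mpr ⟨hcS, hcK⟩⟩, ?_⟩
        apply Finset.eq_of_subset_of_card_le
        · intro x hx
          rw [Finset.mem_erase, Finset.mem_erase] at hx
          by_contra hxB
          have : x ∈ S \ B := Finset.mem_sdiff.mpr ⟨hx.2.2, hxB⟩
          rw [hpair, Finset.mem_insert, Finset.mem_singleton] at this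
          rcases this with h | h
          · exact hx.2.1 h
          · exact hx.1 h
        · rw [Finset.card_erase_of_mem (Finset.mem_erase.mpr ⟨hkc.symm, hcS⟩),
            Finset.card_erase_of_mem (hKS hkK), hSc, hBc]
          omega
      calc ((Finset.powersetCard q S).filter (fun B => (B ∩ K).card = 2)).card
          ≤ ((K ×ˢ (S \ K)).image (fun p => (S.erase p.1).erase p.2)).card := Finset.card_le_card himg
        _ ≤ (K ×ˢ (S \ K)).card := Finset.card_image_le
        _ = 3 * (q - 1) := by rw [Finset.card_product, hK3, hSdK]
    have hcount' : (((Finset.powersetCard q S).filter (fun B => (B ∩ K).card = 2)).card : ℚ) ≤ 3 * ((q : ℚ) - 1) := by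
      have : (((Finset.powersetCard q S).filter (fun B => (B ∩ K).card = 2)).card : ℚ) ≤ ((3 * (q - 1) : ℕ) : ℚ) := by
        exact_mod_cast hcount
      rw [Nat.cast_mul, Nat.cast_sub hq] at this
      push_cast at this
      linarith
    exact mul_le_mul_of_nonneg_right hcount' hsQ
  linarith

/-- **THE ROW `(q, q+1)` AND ITS HALL FORM ON 𝒞(q) FOR ANY WEIGHTS** satisfying the cascade (Dem) / (Cap) arithmetic
(`f = |E| − q − 1`; `(Dem)`: `f (s_I + s_Q) ≥ f + 1`, `2 g_I + (f−1) g_J ≥ f + 1`, `3 z_J + (f−2) z_F ≥ f`; `(Cap)`: `(q+1) z_F ≤ q+1`,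
`z_J + q g_J ≤ q+1`, `2 g_I + (q−1) s_I ≤ q+1`, `(q−1) + 3(q−1) s_Q ≤ q+1`). -/
theorem profileIneq_oneCircuit_of_weights (q : ℕ) (hq : 1 ≤ q) (K : Finset α) (hKg : K ⊆ gr M) (hK3 : K.card = 3)
    (hKrk : rkN M K = 2) (hclass : ∀ X ⊆ gr M, X.card ≤ q + 2 → ¬ K ⊆ X → rkN M X = X.card)
    (sI sQ gI gJ zJ zF : ℚ) (hsI : 0 ≤ sI) (hsQ : 0 ≤ sQ) (hgI : 0 ≤ gI) (hgJ : 0 ≤ gJ) (hzJ : 0 ≤ zJ) (hzF : 0 ≤ zF)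
    (hdem2 : (((gr M).card - q - 1 : ℕ) : ℚ) + 1 ≤ (((gr M).card - q - 1 : ℕ) : ℚ) * (sI + sQ))
    (hdemG : (((gr M).card - q - 1 : ℕ) : ℚ) + 1 ≤ 2 * gI + (((gr M).card - q - 2 : ℕ) : ℚ) * gJ)
    (hdemZ : (((gr M).card - q - 1 : ℕ) : ℚ) ≤ 3 * zJ + (((gr M).card - q - 3 : ℕ) : ℚ) * zF)
    (hcapF : ((q : ℚ) + 1) * zF ≤ q + 1) (hcapJ : zJ + (q : ℚ) * gJ ≤ q + 1)
    (hcapI : 2 * gI + ((q : ℚ) - 1) * sI ≤ q + 1) (hcapQ : ((q : ℚ) - 1) + 3 * ((q : ℚ) - 1) * sQ ≤ q + 1) :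
    Profile.ProfileIneq M q (q + 1) ∧ Profile.HallIneq M q (q + 1) := by
  let w : Finset α → Finset α → ℚ := fun B S =>
    if B.card = q + 1 ∧ (B ∩ K).card = 3 ∧ S.card = q + 2 then 1
    else if B.card = q ∧ (B ∩ K).card = 2 ∧ S.card = q + 1 then sI
    else if B.card = q ∧ (B ∩ K).card = 2 ∧ S.card = q + 2 ∧ (S ∩ K).card = 3 then sQ
    else if B.card = q ∧ (B ∩ K).card = 1 ∧ S.card = q + 1 ∧ (S ∩ K).card = 2 then gI
    else if B.card = q ∧ (B ∩ K).card = 1 ∧ S.card = q + 1 ∧ (S ∩ K).card = 1 then gJ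
    else if B.card = q ∧ (B ∩ K).card = 0 ∧ S.card = q + 1 ∧ (S ∩ K).card = 1 then zJ
    else if B.card = q ∧ (B ∩ K).card = 0 ∧ S.card = q + 1 ∧ (S ∩ K).card = 0 then zF
    else 0
  have hw_nonneg : ∀ B S, 0 ≤ w B S := by
    intro B S; simp only [w]; split_ifs <;> first | assumption | norm_num
  have hw_a : ∀ B S : Finset α, B.card = q + 1 → (B ∩ K).card = 3 → S.card = q + 2 → w B S = 1 := by
    intro B S h1 h2 h3; simp only [w]; rw [if_pos ⟨h1, h2, h3⟩]
  have hw_a0 : ∀ B S : Finset α, B.card = q + 1 → (B ∩ K).card ≠ 3 → w B S = 0 := by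
    intro B S h1 h2; simp only [w]
    rw [if_neg (by omega), if_neg (by omega), if_neg (by omega), if_neg (by omega), if_neg (by omega),
      if_neg (by omega), if_neg (by omega)]
  have hw_2I : ∀ B S : Finset α, B.card = q → (B ∩ K).card = 2 → S.card = q + 1 → w B S = sI := by
    intro B S h1 h2 h3; simp only [w]; rw [if_neg (by omega), if_pos ⟨h1, h2, h3⟩]
  have hw_2Q : ∀ B S : Finset α, B.card = q → (B ∩ K).card = 2 → S.card = q + 2 → (S ∩ K).card = 3 → w B S = sQ := by
    intro B S h1 h2 h3 h4; simp only [w]; rw [if_neg (by omega), if_neg (by omega), if_pos ⟨h1, h2, h3, h4⟩]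
  have hw_q0 : ∀ B S : Finset α, B.card = q → S.card = q + 2 → (B ∩ K).card ≠ 2 → w B S = 0 := by
    intro B S h1 h2 h3; simp only [w]
    rw [if_neg (by omega), if_neg (by omega), if_neg (by omega), if_neg (by omega), if_neg (by omega),
      if_neg (by omega), if_neg (by omega)]
  have hw_GI : ∀ B S : Finset α, B.card = q → (B ∩ K).card = 1 → S.card = q + 1 → (S ∩ K).card = 2 → w B S = gI := by
    intro B S h1 h2 h3 h4; simp only [w]
    rw [if_neg (by omega), if_neg (by omega), if_neg (by omega), if_pos ⟨h1, h2, h3, h4⟩]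
  have hw_GJ : ∀ B S : Finset α, B.card = q → (B ∩ K).card = 1 → S.card = q + 1 → (S ∩ K).card = 1 → w B S = gJ := by
    intro B S h1 h2 h3 h4; simp only [w]
    rw [if_neg (by omega), if_neg (by omega), if_neg (by omega), if_neg (by omega), if_pos ⟨h1, h2, h3, h4⟩]
  have hw_ZJ : ∀ B S : Finset α, B.card = q → (B ∩ K).card = 0 → S.card = q + 1 → (S ∩ K).card = 1 → w B S = zJ := by
    intro B S h1 h2 h3 h4; simp only [w]
    rw [if_neg (by omega), if_neg (by omega), if_neg (by omega), if_neg (by omega), if_neg (by omega),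
      if_pos ⟨h1, h2, h3, h4⟩]
  have hw_ZF : ∀ B S : Finset α, B.card = q → (B ∩ K).card = 0 → S.card = q + 1 → (S ∩ K).card = 0 → w B S = zF := by
    intro B S h1 h2 h3 h4; simp only [w]
    rw [if_neg (by omega), if_neg (by omega), if_neg (by omega), if_neg (by omega), if_neg (by omega),
      if_neg (by omega), if_pos ⟨h1, h2, h3, h4⟩]
  have hq1 : (0 : ℚ) < (q : ℚ) + 1 := by positivity
  -- (Cap)
  have hcap : ∀ S ∈ Shadow.levelSet M (q + 1),
      ∑ B ∈ (Profile.Rq M q).filter (fun B => B ⊆ S), w B S / ((q : ℚ) + 1) ≤ 1 := by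
    intro S hS
    rw [Profile.mem_levelSet] at hS
    obtain ⟨hSg, hSr⟩ := hS
    have hSq : rkN M S = q + 1 := rkN_eq_iff.mpr hSr
    rw [← Finset.sum_div, div_le_one hq1]
    rcases rank_succ_cases hK3 hKrk hclass hSg hSq with ⟨hSc, hKS⟩ | ⟨hSc, hKS⟩
    · exact cap_shape1 hK3 hKrk hclass w hw_nonneg sI gI gJ zJ zF hw_2I hw_GI hw_GJ hw_ZJ hw_ZF hcapF hcapJ hcapI hq
        hSc hKS
    · exact cap_shape2 hK3 hKrk hclass w hw_nonneg sQ hw_a hw_a0 hw_2Q hw_q0 hsQ hcapQ hq hSc hKS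
  -- (Dem)
  have hdem : ∀ B ∈ Profile.Rq M q, Profile.price M q (q + 1) B ≤
      ∑ S ∈ (Shadow.levelSet M (q + 1)).filter (fun S => B ⊆ S), w B S / ((q : ℚ) + 1) := by
    intro B hB
    rw [ThinRow.price_succ_eq]
    split_ifs with hd
    · rw [← Finset.sum_div]
      apply div_le_div_of_nonneg_right _ hq1.le
      rw [Profile.mem_Rq] at hB
      obtain ⟨hBg, hBr⟩ := hB
      have hBq : rkN M B = q := rkN_eq_iff.mpr hBr
      rcases rank_q_cases hK3 hKrk hclass hBg hBq with ⟨hBc, hKB⟩ | ⟨hBc, hKB⟩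
      · have hm : (B ∩ K).card ≤ 3 := (Finset.card_le_card Finset.inter_subset_right).trans hK3.le
        have hm3 : (B ∩ K).card ≠ 3 := fun h => hKB ((subset_iff_card_inter_eq hK3).mpr h)
        rcases (by omega : (B ∩ K).card = 0 ∨ (B ∩ K).card = 1 ∨ (B ∩ K).card = 2) with h0 | h1 | h2
        · -- type Z
          have hs := dem_small hKg hK3 hclass w hw_nonneg zJ zF (m := 0) (by omega) hw_ZJ hw_ZF hBg hBc h0
          simp only [Nat.sub_zero] at hs
          have hc := crk_add_card_add_one_le hK3 hKrk hKg hBg h0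
          have hc' : (crk M B : ℚ) ≤ (((gr M).card - q - 1 : ℕ) : ℚ) := by exact_mod_cast (by omega : crk M B ≤ (gr M).card - q - 1)
          push_cast at hs
          linarith
        · -- type G
          have hs := dem_small hKg hK3 hclass w hw_nonneg gI gJ (m := 1) (by omega) hw_GI hw_GJ hBg hBc h1
          have hc := crk_add_card_le B hBg
          have hc' : (crk M B : ℚ) ≤ (((gr M).card - q - 1 : ℕ) : ℚ) + 1 := by
            exact_mod_cast (by omega : crk M B ≤ (gr M).card - q - 1 + 1)
          have e : (3 - 1 : ℕ) = 2 := rfl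
          rw [e] at hs
          push_cast at hs
          linarith
        · -- type 2K
          exact dem_twoK hKg hK3 hKrk hclass w hw_nonneg sI sQ hw_2I hw_2Q hdem2 hBg hBc h2
      · exact dem_a hK3 hKrk hclass w hw_nonneg hw_a hBg hBc hKB
    · exact Finset.sum_nonneg (fun S _ => div_nonneg (hw_nonneg B S) hq1.le)
  exact ⟨profileIneq_of_cert q (q + 1) (fun B S => w B S / ((q : ℚ) + 1)) hcap hdem,
    hallIneq_of_cert q (q + 1) (fun B S => w B S / ((q : ℚ) + 1)) (fun B S => div_nonneg (hw_nonneg B S) hq1.le) hcap hdem⟩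

/-- **THEOREM 𝒞(q)**: for every `q ≥ 2` and every finite matroid with a 3-circuit `K` such that every set of at most `q + 2` points not
containing `K` is independent, the row `(q, q+1)` of (Π) holds — by the cascade certificate when `|E| − q − 1 ≥ q`, trivially otherwise. -/
theorem profileIneq_oneCircuit (q : ℕ) (hq : 2 ≤ q) (K : Finset α) (hKg : K ⊆ gr M) (hK3 : K.card = 3)
    (hKrk : rkN M K = 2) (hclass : ∀ X ⊆ gr M, X.card ≤ q + 2 → ¬ K ⊆ X → rkN M X = X.card) :
    Profile.ProfileIneq M q (q + 1) ∧ Profile.HallIneq M q (q + 1) := by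
  rcases Nat.lt_or_ge ((gr M).card - q - 1) q with hlt | hge
  · -- nothing is demanding: the zero certificate
    have hdem : ∀ B ∈ Profile.Rq M q, Profile.price M q (q + 1) B ≤
        ∑ S ∈ (Shadow.levelSet M (q + 1)).filter (fun S => B ⊆ S), (fun _ _ => (0 : ℚ)) B S := by
      intro B hB
      rw [ThinRow.price_succ_eq]
      split_ifs with hd
      · exfalso
        rw [Profile.mem_Rq] at hB
        have hBq : rkN M B = q := rkN_eq_iff.mpr hB.2
        have h1 := crk_add_card_le B hB.1
        have h2 : q ≤ B.card := hBq ▸ rkN_le_card B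
        omega
      · simp
    have hcap : ∀ S ∈ Shadow.levelSet M (q + 1),
        ∑ B ∈ (Profile.Rq M q).filter (fun B => B ⊆ S), (fun _ _ => (0 : ℚ)) B S ≤ 1 := by
      intro S _; simp
    exact ⟨profileIneq_of_cert q (q + 1) (fun _ _ => (0 : ℚ)) hcap hdem,
      hallIneq_of_cert q (q + 1) (fun _ _ => (0 : ℚ)) (fun _ _ => le_refl 0) hcap hdem⟩
  · have hw := Cascade.cascade_weights hq hge
    dsimp only at hw
    obtain ⟨h1, h2, h3, h4, h5, h6, h7, h8, h9⟩ := hw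
    have hf2 : 2 ≤ (gr M).card - q - 1 := by omega
    have e1 : (gr M).card - q - 2 = (gr M).card - q - 1 - 1 := by omega
    have e2 : (gr M).card - q - 3 = (gr M).card - q - 1 - 2 := by omega
    refine profileIneq_oneCircuit_of_weights q (by omega) K hKg hK3 hKrk hclass _ _ _ _ (2 / 3) 1 h2 h1 h3 h4
      (by norm_num) (by norm_num) (le_of_eq h5.symm) ?_ ?_ (by linarith) h7 h8 h9
    · rw [e1, Nat.cast_sub (by omega : 1 ≤ (gr M).card - q - 1)]
      push_cast
      linarith
    · rw [e2, Nat.cast_sub hf2]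
      push_cast
      linarith

/-- THEOREM 𝒞(q), the row alone. -/
theorem profileIneq_oneCircuit' (q : ℕ) (hq : 2 ≤ q) (K : Finset α) (hKg : K ⊆ gr M) (hK3 : K.card = 3)
    (hKrk : rkN M K = 2) (hclass : ∀ X ⊆ gr M, X.card ≤ q + 2 → ¬ K ⊆ X → rkN M X = X.card) :
    Profile.ProfileIneq M q (q + 1) :=
  (profileIneq_oneCircuit q hq K hKg hK3 hKrk hclass).1

/-- THEOREM 𝒞(q), the Hall form (C-033). -/
theorem hallIneq_oneCircuit (q : ℕ) (hq : 2 ≤ q) (K : Finset α) (hKg : K ⊆ gr M) (hK3 : K.card = 3)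
    (hKrk : rkN M K = 2) (hclass : ∀ X ⊆ gr M, X.card ≤ q + 2 → ¬ K ⊆ X → rkN M X = X.card) :
    Profile.HallIneq M q (q + 1) :=
  (profileIneq_oneCircuit q hq K hKg hK3 hKrk hclass).2

end OneCircuit
end PercRepro
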